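import Literature.Probability.RandomPlanarGeometry.SAWPulledLargeForceThirdOrder
import Literature.Probability.RandomPlanarGeometry.SAWPulledMeanExtension
import HarnessLib

/-!
# The large-force law of the pulled self-avoiding bridge on `ℤ²`: extension per step `1 − 2/y + o(1/y)`

Topic `Literature/Probability/RandomPlanarGeometry` (uses `SAWPulledLargeForceThirdOrder.lean` — its window
`Zd.exp_pulledFreeEnergy_window_third` implies the coarse one `y + 2 − 4/y ≤ e^{λ_B(y)} ≤ e^{λ(y)} ≤ y + 2` for `y ≥ 9`, all this file
needs — and `SAWPulledMeanExtension.lean`: the mean span per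
step `E^{B,y}_N[span]/N = Zd.pulledMeanSpan 2 N y / N` of the pulled bridge ensemble and its eventual secant sandwich
`(λ_B(y) − λ_B(y''))/log(y/y'') − ε ≤ E_N/N ≤ (λ_B(y') − λ_B(y))/log(y'/y) + ε`).

Janse van Rensburg–Whittington 2013, §3.2 (arXiv:1307.6457 v4 p. 11): Theorem 8 «`λ(y)` is asymptotic to `log y`» and Corollary 2
(`log y ≤ λ(y) ≤ (1+δ) log y` for `y > y_δ`), and
§3.2 (p. 10): the extension densities `𝓔^λ_±(y) = y d^±λ/dy`. Here, on the square lattice, the lane's window for `λ_B` read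
through chords of length `log(1 + y^{−1/2})`:

* `Zd.rightExtension y = d⁺λ_B(e^θ)/dθ|_{θ = log y}`, `Zd.leftExtension y` (`𝓔^λ_±(y)`; exist by convexity; `≤ 1`);
* explicit windows: `Zd.lowG(s) ≤ y(1 − rightExtension y) ≤ y(1 − leftExtension y) ≤ Zd.upG(s)`, `s = y^{−1/2}`, `y ≥ 16`,
  with rational functions `lowG(0) = upG(0) = 2`;
* **`Zd.tendsto_mul_one_sub_rightExtension` / `…leftExtension`: `y(1 − 𝓔^λ_±(y)) → 2`** — at large force the pulled bridge
  is stretched except for a fraction `2/y + o(1/y)` of its steps;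
* finite volume: for `y ≥ 16` and every `δ > 0`, eventually `lowG(s) − δ ≤ y(1 − E^{B,y}_N[span]/N) ≤ upG(s) + δ`
  (`Zd.eventually_meanSpan_largeForce`).
The companion statement for the pulled ADSORBING walk in its ballistic phase (`y(1 − ĥ_±(a,y)) → 2`) needs `y_c(a)` from
`SAWAdsorptionPulledBoundary.lean` / `SAWAdsorptionPulledHeight.lean` and is a separate file.

Label: NEW-IN-WRITING modest (explicit large-force law on `ℤ²`; print: `λ(y) ∼ log y`). Pure standard axioms.
(Lane «pcv-sawmu», a-p3 g12; re-based on the tree's third-order window by a-p3 g14.)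
-/

noncomputable section

open Finset Filter Topology Literature.Probability.LatticeModels SimpleGraph
open scoped BigOperators

namespace Literature.Probability.RandomPlanarGeometry.SAW.Zd

/-! ### The extension densities `𝓔^λ_±` -/

/-- `λ̃(θ) = λ_B(e^θ)`. [cite: JansevanRensburgWhittington2013, §3.2 (arXiv v4 p. 10: 𝓔^λ_±(y) = y d^±λ/dy)] -/
def lamTilde (θ : ℝ) : ℝ := pulledBridgeFreeEnergy 2 (Real.exp θ)

/-- `λ̃` is convex. [cite: Beaton2015, §3] -/
theorem convexOn_lamTilde : ConvexOn ℝ Set.univ lamTilde := pulledBridgeFreeEnergy_exp_convexOn 1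

/-- Every point is interior to `univ`. [folklore] -/
private theorem mem_interior_univ'' (θ : ℝ) : θ ∈ interior (Set.univ : Set ℝ) := by simp

/-- **`𝓔^λ_+(y) := d⁺λ̃/dθ` at `θ = log y`** (right extension density). [cite: JansevanRensburgWhittington2013, §3.2 (arXiv v4 p. 10)] -/
def rightExtension (y : ℝ) : ℝ := derivWithin lamTilde (Set.Ioi (Real.log y)) (Real.log y)

/-- **`𝓔^λ_-(y) := d⁻λ̃/dθ` at `θ = log y`.** [cite: JansevanRensburgWhittington2013, §3.2 (arXiv v4 p. 10)] -/
def leftExtension (y : ℝ) : ℝ := derivWithin lamTilde (Set.Iio (Real.log y)) (Real.log y)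

/-- `𝓔^λ_- ≤ 𝓔^λ_+`. [cite: JansevanRensburgWhittington2013, §3.2 (arXiv v4 p. 10)] -/
theorem leftExtension_le_rightExtension (y : ℝ) : leftExtension y ≤ rightExtension y :=
  convexOn_lamTilde.leftDeriv_le_rightDeriv_of_mem_interior (mem_interior_univ'' _)

/-- `𝓔^λ_+(y) ≤` every right chord of `λ̃` from `log y`. [cite: JansevanRensburgWhittington2013, §3.2 (arXiv v4 p. 10)] -/
theorem rightExtension_le_slope {y : ℝ} {θ' : ℝ} (h : Real.log y < θ') : rightExtension y ≤ slope lamTilde (Real.log y) θ' :=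
  convexOn_lamTilde.rightDeriv_le_slope_of_mem_interior (mem_interior_univ'' _) (Set.mem_univ θ') h

/-- Every left chord of `λ̃` into `log y` is `≤ 𝓔^λ_-(y)`. [cite: JansevanRensburgWhittington2013, §3.2 (arXiv v4 p. 10)] -/
theorem slope_le_leftExtension {y : ℝ} {θ' : ℝ} (h : θ' < Real.log y) : slope lamTilde θ' (Real.log y) ≤ leftExtension y :=
  convexOn_lamTilde.slope_le_leftDeriv_of_mem_interior (Set.mem_univ θ') (mem_interior_univ'' _) h

/-! ### The comparison functions (`s = y^{−1/2}`) -/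

/-- Lower comparison `G₁(s) = 2(1 − 2s − 2s²)/((1 + s + 2s²)(1 + W(s)))`, `W(s) = 2s³(1−2s−2s²)/(1+s+2s²)`. [cite: JansevanRensburgWhittington2013, §3.2 Corollary 2 (arXiv v4 p. 11)] -/
def lowW (s : ℝ) : ℝ := 2 * s ^ 3 * (1 - 2 * s - 2 * s ^ 2) / (1 + s + 2 * s ^ 2)

/-- Lower comparison function. [cite: JansevanRensburgWhittington2013, §3.2 Corollary 2 (arXiv v4 p. 11)] -/
def lowG (s : ℝ) : ℝ := 2 * (1 - 2 * s - 2 * s ^ 2) / ((1 + s + 2 * s ^ 2) * (1 + lowW s))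

/-- Upper comparison function `G₂(s) = 2(1+2s)(1+s)/(1 + 2s² − 4s⁴)`. [cite: JansevanRensburgWhittington2013, §3.2 Corollary 2 (arXiv v4 p. 11)] -/
def upG (s : ℝ) : ℝ := 2 * (1 + 2 * s) * (1 + s) / (1 + 2 * s ^ 2 - 4 * s ^ 4)

/-- `G₁ → 2` as `s → 0`. [cite: JansevanRensburgWhittington2013, §3.2 Corollary 2 (arXiv v4 p. 11)] -/
theorem tendsto_lowG : Tendsto lowG (𝓝 0) (𝓝 2) := by
  have hc : ContinuousAt lowG 0 := by
    unfold lowG lowW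
    refine ContinuousAt.div (by fun_prop) ?_ (by norm_num)
    exact ContinuousAt.mul (by fun_prop) (ContinuousAt.add continuousAt_const (ContinuousAt.div (by fun_prop) (by fun_prop) (by norm_num)))
  have := hc.tendsto
  rwa [show lowG 0 = 2 by norm_num [lowG, lowW]] at this

/-- `G₂ → 2` as `s → 0`. [cite: JansevanRensburgWhittington2013, §3.2 Corollary 2 (arXiv v4 p. 11)] -/
theorem tendsto_upG : Tendsto upG (𝓝 0) (𝓝 2) := by
  have hc : ContinuousAt upG 0 := by
    unfold upG
    exact ContinuousAt.div (by fun_prop) (by fun_prop) (by norm_num)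
  have := hc.tendsto
  rwa [show upG 0 = 2 by norm_num [upG]] at this

/-- `log(1+w) ≥ w/(1+w)` (`1 + w > 0`). [folklore] -/
private theorem div_le_log_one_add₃ {w : ℝ} (hw : 0 < 1 + w) : w / (1 + w) ≤ Real.log (1 + w) := by
  have := Real.one_sub_inv_le_log_of_pos hw
  rwa [show 1 - (1 + w)⁻¹ = w / (1 + w) by field_simp; ring] at this

/-- `log(1+w) ≤ w` (`1 + w > 0`). [folklore] -/
private theorem log_one_add_le₃ {w : ℝ} (hw : 0 < 1 + w) : Real.log (1 + w) ≤ w := by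
  have := Real.log_le_sub_one_of_pos hw; linarith

/-! ### The coarse window (from the third-order window of `SAWPulledLargeForceThirdOrder`) -/

/-- `y + 2 − 4/y ≤ e^{λ_B(y)} ≤ e^{λ(y)} ≤ y + 2` for `y ≥ 9` (the third-order window implies the first-order one).
[cite: JansevanRensburgWhittington2013, §3.2 Corollary 2 (arXiv v4 p. 11)] -/
private theorem window_coarse {y : ℝ} (hy : 9 ≤ y) :
    y + 2 - 4 / y ≤ Real.exp (pulledBridgeFreeEnergy 2 y) ∧
      Real.exp (pulledBridgeFreeEnergy 2 y) ≤ Real.exp (max (Real.log (connectiveConstant 2)) (pulledBridgeFreeEnergy 2 y)) ∧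
      Real.exp (max (Real.log (connectiveConstant 2)) (pulledBridgeFreeEnergy 2 y)) ≤ y + 2 := by
  have hy0 : 0 < y := by linarith
  obtain ⟨h1, h2, h3⟩ := exp_pulledFreeEnergy_window_third hy
  refine ⟨le_trans ?_ h1, h2, h3.trans ?_⟩
  · have e : y + 2 - 2 / y + 6 / y ^ 2 - 20 / y ^ 3 - (y + 2 - 4 / y) = (2 * y ^ 2 + 6 * y - 20) / y ^ 3 := by
      field_simp; ring
    have : 0 ≤ (2 * y ^ 2 + 6 * y - 20) / y ^ 3 := div_nonneg (by nlinarith) (by positivity)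
    linarith
  · have e : y + 2 - (y + 2 - 2 / y + 6 / y ^ 2 - 20 / y ^ 3 + 300 / y ^ 4) = (2 * y ^ 3 - 6 * y ^ 2 + 20 * y - 300) / y ^ 4 := by
      field_simp; ring
    have : 0 ≤ (2 * y ^ 3 - 6 * y ^ 2 + 20 * y - 300) / y ^ 4 := div_nonneg (by nlinarith) (by positivity)
    linarith

/-! ### The two chord bounds (on secants; derivative-free cores) -/

/-- **Upper secant at large force: `G₁(s)·s² ≤ 1 − (λ_B(y(1+s)) − λ_B(y))/log(1+s)` for `y ≥ 9`, `s = y^{−1/2}`.**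
[cite: JansevanRensburgWhittington2013, §3.2 Corollary 2 (arXiv v4 p. 11)] -/
theorem lowG_mul_le_one_sub_secant {y : ℝ} (hy : 9 ≤ y) :
    lowG (Real.sqrt y)⁻¹ * (Real.sqrt y)⁻¹ ^ 2 ≤
      1 - (pulledBridgeFreeEnergy 2 (y * (1 + (Real.sqrt y)⁻¹)) - pulledBridgeFreeEnergy 2 y) /
        (Real.log (y * (1 + (Real.sqrt y)⁻¹)) - Real.log y) := by
  have hy0 : 0 < y := by linarith
  set s := (Real.sqrt y)⁻¹ with hs_def
  have hsq : Real.sqrt y ^ 2 = y := Real.sq_sqrt hy0.le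
  have hsqrt3 : 3 ≤ Real.sqrt y := by
    rw [show (3:ℝ) = Real.sqrt 9 by rw [show (9:ℝ) = 3 ^ 2 by norm_num, Real.sqrt_sq (by norm_num)]]
    exact Real.sqrt_le_sqrt hy
  have hsqrt0 : 0 < Real.sqrt y := by linarith
  have hs0 : 0 < s := inv_pos.2 hsqrt0
  have hs3 : s ≤ 1 / 3 := by rw [hs_def, inv_eq_one_div]; exact div_le_div_of_nonneg_left zero_le_one (by norm_num) hsqrt3
  have hys : y = 1 / s ^ 2 := by rw [hs_def, inv_pow, hsq, one_div, inv_inv]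
  set y' := y * (1 + s) with hy'
  have hy'2 : 2 ≤ y' := by rw [hy']; nlinarith
  have hh : Real.log y' - Real.log y = Real.log (1 + s) := by
    rw [← Real.log_div (by linarith) hy0.ne', hy', mul_div_cancel_left₀ _ hy0.ne']
  have hlog1s : 0 < Real.log (1 + s) := Real.log_pos (by linarith)
  have hy'9 : 9 ≤ y' := by rw [hy']; nlinarith
  obtain ⟨hlow, -, -⟩ := window_coarse hy
  obtain ⟨-, hmid', hup'⟩ := window_coarse hy'9
  have hup : Real.exp (pulledBridgeFreeEnergy 2 y') ≤ y' + 2 := hmid'.trans hup'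
  have hr0 : 0 < y + 2 - 4 / y := by
    have : 4 / y ≤ 2 := by rw [div_le_iff₀ hy0]; linarith
    linarith
  have hLy : Real.log (y + 2 - 4 / y) ≤ pulledBridgeFreeEnergy 2 y := by
    have := Real.log_le_log hr0 hlow; rwa [Real.log_exp] at this
  have hUy' : pulledBridgeFreeEnergy 2 y' ≤ Real.log (y' + 2) := by
    have := Real.log_le_log (Real.exp_pos _) hup; rwa [Real.log_exp] at this
  have hW_def : (1 + s) * (y + 2 - 4 / y) / (y' + 2) = 1 + lowW s := by
    rw [hy', hys, lowW]
    have hs1 : (1 + s + 2 * s ^ 2) ≠ 0 := by positivity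
    field_simp
    ring
  have hWpos : 0 < lowW s := by
    rw [lowW]
    apply div_pos _ (by positivity)
    have : 0 < 1 - 2 * s - 2 * s ^ 2 := by nlinarith
    positivity
  have hlogW : Real.log (1 + lowW s) = Real.log (1 + s) + Real.log (y + 2 - 4 / y) - Real.log (y' + 2) := by
    rw [← hW_def, Real.log_div (by positivity) (by linarith), Real.log_mul (by linarith) hr0.ne']
  have key : Real.log (1 + lowW s) / Real.log (1 + s) ≤
      1 - (pulledBridgeFreeEnergy 2 y' - pulledBridgeFreeEnergy 2 y) / (Real.log y' - Real.log y) := by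
    rw [hh, div_le_iff₀ hlog1s, hlogW, sub_mul, div_mul_cancel₀ _ hlog1s.ne', one_mul]
    linarith
  have hlow2 : lowG s * s ^ 2 ≤ Real.log (1 + lowW s) / Real.log (1 + s) := by
    rw [le_div_iff₀ hlog1s]
    have h1 := div_le_log_one_add₃ (show 0 < 1 + lowW s by linarith)
    have h2 := log_one_add_le₃ (show 0 < 1 + s by linarith)
    have hG0 : 0 ≤ lowG s * s ^ 2 := by
      have : 0 < lowG s := by
        rw [lowG]; apply div_pos _ (by positivity); nlinarith
      positivity
    calc lowG s * s ^ 2 * Real.log (1 + s) ≤ lowG s * s ^ 2 * s := mul_le_mul_of_nonneg_left h2 hG0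
      _ = lowW s / (1 + lowW s) := by
          rw [lowG, lowW]
          have hs1 : (1 + s + 2 * s ^ 2) ≠ 0 := by positivity
          field_simp
      _ ≤ Real.log (1 + lowW s) := h1
  exact hlow2.trans key

/-- **Lower secant at large force: `1 − (λ_B(y) − λ_B(y/(1+s)))/log(1+s) ≤ G₂(s)·s²` for `y ≥ 9`, `s = y^{−1/2}`.**
[cite: JansevanRensburgWhittington2013, §3.2 Corollary 2 (arXiv v4 p. 11)] -/
theorem one_sub_secant_le_upG_mul {y : ℝ} (hy16 : 16 ≤ y) :
    1 - (pulledBridgeFreeEnergy 2 y - pulledBridgeFreeEnergy 2 (y / (1 + (Real.sqrt y)⁻¹))) /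
        (Real.log y - Real.log (y / (1 + (Real.sqrt y)⁻¹))) ≤ upG (Real.sqrt y)⁻¹ * (Real.sqrt y)⁻¹ ^ 2 := by
  have hy : (9 : ℝ) ≤ y := by linarith
  have hy0 : 0 < y := by linarith
  set s := (Real.sqrt y)⁻¹ with hs_def
  have hsq : Real.sqrt y ^ 2 = y := Real.sq_sqrt hy0.le
  have hsqrt3 : 3 ≤ Real.sqrt y := by
    rw [show (3:ℝ) = Real.sqrt 9 by rw [show (9:ℝ) = 3 ^ 2 by norm_num, Real.sqrt_sq (by norm_num)]]
    exact Real.sqrt_le_sqrt hy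
  have hsqrt0 : 0 < Real.sqrt y := by linarith
  have hs0 : 0 < s := inv_pos.2 hsqrt0
  have hs3 : s ≤ 1 / 3 := by rw [hs_def, inv_eq_one_div]; exact div_le_div_of_nonneg_left zero_le_one (by norm_num) hsqrt3
  have hys : y = 1 / s ^ 2 := by rw [hs_def, inv_pow, hsq, one_div, inv_inv]
  set y'' := y / (1 + s) with hy''
  have h1s : 0 < 1 + s := by linarith
  have hy''2 : 2 ≤ y'' := by rw [hy'', le_div_iff₀ h1s]; nlinarith
  have hy''0 : 0 < y'' := by linarith
  have hh : Real.log y - Real.log y'' = Real.log (1 + s) := by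
    rw [← Real.log_div hy0.ne' hy''0.ne', hy'']
    congr 1
    field_simp
  have hlog1s : 0 < Real.log (1 + s) := Real.log_pos (by linarith)
  have hsqrt4 : 4 ≤ Real.sqrt y := by
    rw [show (4:ℝ) = Real.sqrt 16 by rw [show (16:ℝ) = 4 ^ 2 by norm_num, Real.sqrt_sq (by norm_num)]]
    exact Real.sqrt_le_sqrt hy16
  have hs4 : s ≤ 1 / 4 := by rw [hs_def, inv_eq_one_div]; exact div_le_div_of_nonneg_left zero_le_one (by norm_num) hsqrt4
  have hy''9 : 9 ≤ y'' := by rw [hy'', le_div_iff₀ h1s]; nlinarith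
  obtain ⟨hlow, -, -⟩ := window_coarse hy
  obtain ⟨-, hmid'', hup''⟩ := window_coarse hy''9
  have hup : Real.exp (pulledBridgeFreeEnergy 2 y'') ≤ y'' + 2 := hmid''.trans hup''
  have hr0 : 0 < y + 2 - 4 / y := by
    have : 4 / y ≤ 2 := by rw [div_le_iff₀ hy0]; linarith
    linarith
  have hLy : Real.log (y + 2 - 4 / y) ≤ pulledBridgeFreeEnergy 2 y := by
    have := Real.log_le_log hr0 hlow; rwa [Real.log_exp] at this
  have hUy'' : pulledBridgeFreeEnergy 2 y'' ≤ Real.log (y'' + 2) := by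
    have := Real.log_le_log (Real.exp_pos _) hup; rwa [Real.log_exp] at this
  have hden : 0 < 1 + 2 * s ^ 2 - 4 * s ^ 4 := by
    have hs2 : s ^ 2 ≤ 1 / 9 := by nlinarith
    have e4 : s ^ 4 = s ^ 2 * s ^ 2 := by ring
    nlinarith [sq_nonneg s]
  have hden' : 1 + 2 * s ^ 2 - 4 * s ^ 4 ≠ 0 := hden.ne'
  have hW_def : (1 + s) * (y'' + 2) / (y + 2 - 4 / y) = 1 + 2 * s ^ 3 * (1 + 2 * s) / (1 + 2 * s ^ 2 - 4 * s ^ 4) := by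
    have hs2 : s ^ 2 ≠ 0 := by positivity
    have e1 : y + 2 - 4 / y = (1 + 2 * s ^ 2 - 4 * s ^ 4) / s ^ 2 := by rw [hys]; field_simp
    have e2 : (1 + s) * (y'' + 2) = (1 + 2 * s ^ 2 + 2 * s ^ 3) / s ^ 2 := by rw [hy'', hys]; field_simp; ring
    rw [e2, e1, div_div_div_cancel_right₀ hs2, div_eq_iff hden', add_mul, div_mul_cancel₀ _ hden']
    ring
  set W := 2 * s ^ 3 * (1 + 2 * s) / (1 + 2 * s ^ 2 - 4 * s ^ 4) with hW
  have hWpos : 0 < W := by positivity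
  have hlogW : Real.log (1 + W) = Real.log (1 + s) + Real.log (y'' + 2) - Real.log (y + 2 - 4 / y) := by
    rw [← hW_def, Real.log_div (by positivity) hr0.ne', Real.log_mul (by linarith) (by linarith)]
  have key : 1 - (pulledBridgeFreeEnergy 2 y - pulledBridgeFreeEnergy 2 y'') / (Real.log y - Real.log y'') ≤
      Real.log (1 + W) / Real.log (1 + s) := by
    rw [hh, le_div_iff₀ hlog1s, hlogW, sub_mul, div_mul_cancel₀ _ hlog1s.ne', one_mul]
    linarith
  have hup2 : Real.log (1 + W) / Real.log (1 + s) ≤ upG s * s ^ 2 := by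
    rw [div_le_iff₀ hlog1s]
    have h1 := log_one_add_le₃ (show 0 < 1 + W by linarith)
    have h2 := div_le_log_one_add₃ (show 0 < 1 + s by linarith)
    have hG0 : 0 ≤ upG s * s ^ 2 := by rw [upG]; positivity
    calc Real.log (1 + W) ≤ W := h1
      _ = upG s * s ^ 2 * (s / (1 + s)) := by rw [hW, upG]; field_simp
      _ ≤ upG s * s ^ 2 * Real.log (1 + s) := mul_le_mul_of_nonneg_left h2 hG0
  exact key.trans hup2

/-- `y · s² = 1` for `s = y^{−1/2}`, `y > 0`. [folklore] -/
private theorem mul_inv_sqrt_sq {y : ℝ} (hy : 0 < y) : y * (Real.sqrt y)⁻¹ ^ 2 = 1 := by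
  rw [inv_pow, Real.sq_sqrt hy.le, mul_inv_cancel₀ hy.ne']

/-- **The large-force window for the extension densities: `G₁(s) ≤ y(1 − 𝓔^λ_+(y)) ≤ y(1 − 𝓔^λ_-(y)) ≤ G₂(s)` (`y ≥ 16`).**
[cite: JansevanRensburgWhittington2013, §3.2 Corollary 2 (arXiv v4 p. 11)] -/
theorem extension_largeForce_window {y : ℝ} (hy16 : 16 ≤ y) :
    lowG (Real.sqrt y)⁻¹ ≤ y * (1 - rightExtension y) ∧ y * (1 - rightExtension y) ≤ y * (1 - leftExtension y) ∧
      y * (1 - leftExtension y) ≤ upG (Real.sqrt y)⁻¹ := by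
  have hy : (9 : ℝ) ≤ y := by linarith
  have hy0 : 0 < y := by linarith
  set s := (Real.sqrt y)⁻¹ with hs_def
  have hsqrt0 : 0 < Real.sqrt y := Real.sqrt_pos.2 hy0
  have hs0 : 0 < s := inv_pos.2 hsqrt0
  have h1 := mul_inv_sqrt_sq hy0
  refine ⟨?_, mul_le_mul_of_nonneg_left (by linarith [leftExtension_le_rightExtension y]) hy0.le, ?_⟩
  · -- right derivative ≤ right secant
    have hθ : Real.log y < Real.log (y * (1 + s)) := Real.log_lt_log hy0 (by nlinarith)
    have hr := rightExtension_le_slope hθ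
    have hsl : slope lamTilde (Real.log y) (Real.log (y * (1 + s))) =
        (pulledBridgeFreeEnergy 2 (y * (1 + s)) - pulledBridgeFreeEnergy 2 y) / (Real.log (y * (1 + s)) - Real.log y) := by
      rw [slope_def_field, lamTilde, lamTilde, Real.exp_log (by nlinarith), Real.exp_log hy0]
    rw [hsl] at hr
    have hc := lowG_mul_le_one_sub_secant hy
    calc lowG s = lowG s * s ^ 2 * y := by rw [mul_assoc, mul_comm (s ^ 2), h1, mul_one]
      _ ≤ (1 - rightExtension y) * y := mul_le_mul_of_nonneg_right (by linarith) hy0.le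
      _ = y * (1 - rightExtension y) := mul_comm _ _
  · -- left secant ≤ left derivative
    have h1s : 0 < 1 + s := by linarith
    have hy''0 : 0 < y / (1 + s) := div_pos hy0 h1s
    have hθ : Real.log (y / (1 + s)) < Real.log y := Real.log_lt_log hy''0 (by rw [div_lt_iff₀ h1s]; nlinarith)
    have hl := slope_le_leftExtension hθ
    have hsl : slope lamTilde (Real.log (y / (1 + s))) (Real.log y) =
        (pulledBridgeFreeEnergy 2 y - pulledBridgeFreeEnergy 2 (y / (1 + s))) / (Real.log y - Real.log (y / (1 + s))) := by
      rw [slope_def_field, lamTilde, lamTilde, Real.exp_log hy''0, Real.exp_log hy0]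
    rw [hsl] at hl
    have hc := one_sub_secant_le_upG_mul hy16
    calc y * (1 - leftExtension y) ≤ y * (upG s * s ^ 2) := mul_le_mul_of_nonneg_left (by linarith) hy0.le
      _ = upG s := by rw [mul_comm (upG s), ← mul_assoc, h1, one_mul]

/-- `y^{−1/2} → 0`. [folklore] -/
private theorem tendsto_inv_sqrt : Tendsto (fun y : ℝ => (Real.sqrt y)⁻¹) atTop (𝓝 0) :=
  tendsto_inv_atTop_zero.comp Real.tendsto_sqrt_atTop

/-- **`y (1 − 𝓔^λ_+(y)) → 2`**: the pulled bridge at large force leaves a fraction `2/y + o(1/y)` of its steps unstretched.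
[cite: JansevanRensburgWhittington2013, §3.2 Corollary 2 (arXiv v4 p. 11: log y ≤ λ(y) ≤ (1+δ) log y) and Theorem 8 («λ(y) is asymptotic to log y»)] -/
theorem tendsto_mul_one_sub_rightExtension : Tendsto (fun y : ℝ => y * (1 - rightExtension y)) atTop (𝓝 2) := by
  have hl := tendsto_lowG.comp tendsto_inv_sqrt
  have hu := tendsto_upG.comp tendsto_inv_sqrt
  refine tendsto_of_tendsto_of_tendsto_of_le_of_le' hl hu ?_ ?_
  · filter_upwards [eventually_ge_atTop (16:ℝ)] with y hy using (extension_largeForce_window hy).1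
  · filter_upwards [eventually_ge_atTop (16:ℝ)] with y hy using
      (extension_largeForce_window hy).2.1.trans (extension_largeForce_window hy).2.2

/-- **`y (1 − 𝓔^λ_-(y)) → 2`.** [cite: JansevanRensburgWhittington2013, §3.2 Corollary 2 (arXiv v4 p. 11)] -/
theorem tendsto_mul_one_sub_leftExtension : Tendsto (fun y : ℝ => y * (1 - leftExtension y)) atTop (𝓝 2) := by
  have hl := tendsto_lowG.comp tendsto_inv_sqrt
  have hu := tendsto_upG.comp tendsto_inv_sqrt
  refine tendsto_of_tendsto_of_tendsto_of_le_of_le' hl hu ?_ ?_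
  · filter_upwards [eventually_ge_atTop (16:ℝ)] with y hy using
      (extension_largeForce_window hy).1.trans (extension_largeForce_window hy).2.1
  · filter_upwards [eventually_ge_atTop (16:ℝ)] with y hy using (extension_largeForce_window hy).2.2

/-! ### Finite volume: the mean span per step of pulled bridges at large force -/

/-- **Eventually in `N`: `G₁(s) − δ ≤ y(1 − E^{B,y}_N[span]/N) ≤ G₂(s) + δ`** for `y ≥ 16`, `s = y^{−1/2}`, every `δ > 0`.
[cite: Beaton2015, §2 (λ(y)), §3] -/
theorem eventually_meanSpan_largeForce {y δ : ℝ} (hy16 : 16 ≤ y) (hδ : 0 < δ) :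
    ∀ᶠ N : ℕ in atTop, lowG (Real.sqrt y)⁻¹ - δ ≤ y * (1 - pulledMeanSpan 2 N y / N) ∧
      y * (1 - pulledMeanSpan 2 N y / N) ≤ upG (Real.sqrt y)⁻¹ + δ := by
  have hy : (9 : ℝ) ≤ y := by linarith
  have hy0 : 0 < y := by linarith
  set s := (Real.sqrt y)⁻¹ with hs_def
  have hsqrt0 : 0 < Real.sqrt y := Real.sqrt_pos.2 hy0
  have hs0 : 0 < s := inv_pos.2 hsqrt0
  have h1 := mul_inv_sqrt_sq hy0
  have hyy' : y < y * (1 + s) := by nlinarith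
  have h1s : 0 < 1 + s := by linarith
  have hy''y : y / (1 + s) < y := by rw [div_lt_iff₀ h1s]; nlinarith
  have hy''0 : 0 < y / (1 + s) := div_pos hy0 h1s
  have hε : 0 < δ / y := div_pos hδ hy0
  have hU := eventually_pulledMeanSpan_div_le 1 hy0 hyy' hε
  have hL := eventually_le_pulledMeanSpan_div 1 hy''0 hy''y hε
  have hcU := lowG_mul_le_one_sub_secant hy
  have hcL := one_sub_secant_le_upG_mul hy16
  filter_upwards [hU, hL] with N hNU hNL
  have e1 : lowG s = lowG s * s ^ 2 * y := by rw [mul_assoc, mul_comm (s ^ 2), h1, mul_one]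
  have e2 : upG s = upG s * s ^ 2 * y := by rw [mul_assoc, mul_comm (s ^ 2), h1, mul_one]
  have e3 : δ = δ / y * y := by field_simp
  constructor
  · rw [e1, e3]; nlinarith
  · rw [e2, e3]; nlinarith

end Literature.Probability.RandomPlanarGeometry.SAW.Zd
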